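import Summits.AtomisticToContinuum.HydrodynamicLimit.Theorems.MourreKoopmanChargesLinearToEntropyInBandDefs
import Summits.AtomisticToContinuum.HydrodynamicLimit.Theorems.ImplosionDichotomyHydroLimitInBandOfHeart
import Summits.AtomisticToContinuum.HydrodynamicLimit.Theorems.ImplosionDichotomyHydroLimitInBandWindowContinuity
import HarnessLib

/-!
# Crux `MourreKoopmanCharges.LinearToEntropyInBand` (stmt-AtomisticToContinuum-17740), line `registered`:
ledger glue for stub 4 (`stub_ballwiseLedgerVisibleInBand`, skeleton v4), wave 2

Helper file (`--supports stmt-AtomisticToContinuum-17740`).  The v4 stub 4 concludes Yau's INTEGRATED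
one-window entropy ledger `ClampedCurrentsDockFromWindows.LedgerIntegratedCoreInBand`.  The landed summation
`ClampedCurrentsDockFromWindows.stub_ledgerFromWindowsS` (crux 14680) fed with the landed a-priori bound
`EntropyClockDock.ledgerAprioriBound` makes the integrated ledger a consequence of the STATIC one-window
ledger `OneWindowLedgerStatic` (the heart) and the crude window continuity `WindowContinuityInBand`, and
the landed `HydroLimitInBandContinuity.stub_windowContinuityInBand` (crux 9133, p118327) gives the window
continuity from the three true-law inputs CAT (`OneFlightGossipEngine.CollisionActivityTails`, 13734),
CEAT (`HydroLimitInBandOfHeart.CollisionEnergyActivityTails`, 17703) and ECT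
(`OneFlightGossipEngine.EnergyCurrentTails`, 9235), each used at ONE level.  This file records, kernel-
checked, the glue that makes the reshape `stub 4 ⇐ 4a (static ledger) ∧ 4b (window continuity)` safe:

* §1 `glue_ledgerOfStaticAndContinuity` (registered glue): `4a → WindowContinuityInBand → (v4 stub 4)`;
  `glue_windowContinuityInBand_of_tails` (registered glue): `CAT → CEAT → ECT → WindowContinuityInBand`,
  the landed 9133 theorem re-exported in this crux's vocabulary (its line-local copies of CEAT and of
  `WindowContinuityInBand` are byte-identical with the `HydroLimitInBandOfHeart` /
  `ClampedCurrentsDockFromWindows` ones, so the matching is `exact`).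
* §2 the PACKING-GUARDED variant, which keeps the line's cubic-tail input guarded:
  `WindowContinuityInBandBelow η` (spelled inline, no new definition) is `WindowContinuityInBand` with
  the guard `∀ s ∈ [0,T) ∀ x, ρ_s(x)σ³ < η` inserted after the solution hypothesis (the position it has
  in `LTEInBand.EnergyCurrentTailsBelow η`); `glue_windowContinuityInBandBelow_of_tails`:
  `CAT → CEAT → EnergyCurrentTailsBelow η → WindowContinuityInBandBelow η` (the 9133 proof verbatim, the
  guard handed to ECT); `glue_ledgerOfStaticAndContinuityBelow`:
  `0 < η → OneWindowLedgerStatic → WindowContinuityInBandBelow η → LedgerIntegratedCoreInBand` (the 14680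
  summation verbatim with `ηp := min ηp₁ (min (r/2) η)`); and the composition
  `glue_ballwiseLedger_of_static_of_activityTails`: `4a → CAT → CEAT → (v4 stub 4)`.

Nothing here restates the crux, the route's items or the Statement; CAT / CEAT / ECT enter only as
hypotheses.  References: Yau1991 §2, OllaVaradhanYau1993 §3.
-/

noncomputable section

open MeasureTheory Filter Set Topology InformationTheory
open scoped ENNReal

namespace Summit.AtomisticToContinuum.HydrodynamicLimit.Theorems.LTEInBand

open Literature.MathematicalPhysics.KineticTheory Literature.Analysis.FluidPDE
open Literature.Analysis.FunctionSpaces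
open Summit.AtomisticToContinuum.HydrodynamicLimit.Theses
open Summit.AtomisticToContinuum.HydrodynamicLimit.Theorems
  (lintegral_meanVelObs_localGibbsMeasure_le lintegral_norm_sq_gaussMeasure)
open Summit.AtomisticToContinuum.HydrodynamicLimit.Theorems.ClampedCurrentsDockFromWindows
  (LedgerIntegratedCoreInBand WindowContinuityInBand OneWindowLedgerStatic stub_ledgerFromWindowsS
    integrated_of_windows)
open Summit.AtomisticToContinuum.HydrodynamicLimit.Theorems.HydroLimitInBandContinuity
  (abs_klDiv_window_sub_le exists_abs_DgExp_one_le exists_lipschitz_slab isSmoothSpaceTimeOn_momPart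
    isSmoothSpaceTimeOn_inv stub_windowContinuityInBand)

/-! ## §1 The registered glue -/

/-- **Registered glue `glue_ledgerOfStaticAndContinuity` (wave 2, stub 4).** If for every packing level
`η > 0` visible local flux-Gibbsianity and the two level-`η` truncation inputs give the STATIC one-window
ledger (the reshaped stub 4a), and the crude window continuity of `H_N` along the explicit reference family
holds (stub 4b), then the v4 stub 4 holds: the integrated ledger is the landed summation
`ClampedCurrentsDockFromWindows.stub_ledgerFromWindowsS` fed with the landed a-priori bound
`EntropyClockDock.ledgerAprioriBound`. -/
theorem glue_ledgerOfStaticAndContinuity : (∀ η : ℝ, 0 < η → Summit.AtomisticToContinuum.HydrodynamicLimit.Theorems.LTEInBand.VisibleFluxGibbsianity → Summit.AtomisticToContinuum.HydrodynamicLimit.Theorems.LTEInBand.EnergyCurrentTailsBelow η → Summit.AtomisticToContinuum.HydrodynamicLimit.Theorems.LTEInBand.FastCollisionThroughputBelow η → Summit.AtomisticToContinuum.HydrodynamicLimit.Theorems.ClampedCurrentsDockFromWindows.OneWindowLedgerStatic) → Summit.AtomisticToContinuum.HydrodynamicLimit.Theorems.ClampedCurrentsDockFromWindows.WindowContinuityInBand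 → (∀ η : ℝ, 0 < η → Summit.AtomisticToContinuum.HydrodynamicLimit.Theorems.LTEInBand.VisibleFluxGibbsianity → Summit.AtomisticToContinuum.HydrodynamicLimit.Theorems.LTEInBand.EnergyCurrentTailsBelow η → Summit.AtomisticToContinuum.HydrodynamicLimit.Theorems.LTEInBand.FastCollisionThroughputBelow η → Summit.AtomisticToContinuum.HydrodynamicLimit.Theorems.ClampedCurrentsDockFromWindows.LedgerIntegratedCoreInBand) :=
  fun hS hW η hη hV hE hF =>
    stub_ledgerFromWindowsS (hS η hη hV hE hF) hW
      Summit.AtomisticToContinuum.HydrodynamicLimit.Theorems.EntropyClockDock.ledgerAprioriBound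

/-- **Registered glue `glue_windowContinuityInBand_of_tails` (wave 2, stub 4b by name).** CAT (13734), CEAT
(17703) and ECT (9235), each at ONE level, give the crude window continuity of `H_N` along the explicit
reference family, in band: the landed `HydroLimitInBandContinuity.stub_windowContinuityInBand` (crux 9133,
p118327), whose line-local copies of `CollisionEnergyActivityTails` and `WindowContinuityInBand` are
byte-identical with `HydroLimitInBandOfHeart.CollisionEnergyActivityTails` and
`ClampedCurrentsDockFromWindows.WindowContinuityInBand` (definitional matching, `exact`). -/
theorem glue_windowContinuityInBand_of_tails : Summit.AtomisticToContinuum.HydrodynamicLimit.Theses.OneFlightGossipEngine.CollisionActivityTails → Summit.AtomisticToContinuum.HydrodynamicLimit.Theorems.HydroLimitInBandOfHeart.CollisionEnergyActivityTails → Summit.AtomisticToContinuum.HydrodynamicLimit.Theses.OneFlightGossipEngine.EnergyCurrentTails → Summit.AtomisticToContinuum.HydrodynamicLimit.Theorems.ClampedCurrentsDockFromWindows.WindowContinuityInBand :=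
  fun hC hE hT => stub_windowContinuityInBand hC hE hT

/-! ## §2 The packing-guarded variant

`WindowContinuityInBandBelow η` (written INLINE below, no new definition in `Theorems/`) is
`ClampedCurrentsDockFromWindows.WindowContinuityInBand` with the packing guard `∀ s ∈ [0,T) ∀ x, ρ_s(x)σ³ < η`
of the re-typed Statement inserted right after the solution hypothesis (the position it has in
`EnergyCurrentTailsBelow η`); the band hypothesis `ρ_s σ³ < r` on `[0,t]` (the domain of the insertion factor)
is kept.  It is trivially implied by the unguarded statement and antitone in `η`. -/

/-- **Guarded window continuity from CAT, CEAT and the GUARDED cubic tails.** The proof of the landed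
`HydroLimitInBandContinuity.stub_windowContinuityInBand` verbatim, the three inputs at ONE level each
(`ε = 1`; CAT / CEAT at their own `V₀` with the common window `max τ₀ τ`; the guarded ECT with its `M`, the
packing guard at level `η` on `[0,T)` being handed to it), then the landed one-window estimate
`HydroLimitInBandContinuity.abs_klDiv_window_sub_le` at fixed `N` and the bookkeeping
`(N+1) ν_N · const ≤ (N+1) ε`, `ν_N = (N+1)^{-1/3} → 0`. [cite: Yau1991, §2] -/
theorem glue_windowContinuityInBandBelow_of_tails (η : ℝ) (hCAT : OneFlightGossipEngine.CollisionActivityTails)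
    (hCEAT : HydroLimitInBandOfHeart.CollisionEnergyActivityTails) (hECT : EnergyCurrentTailsBelow η) :
    ∀ (r : ℝ) (Rf : ℝ → ℝ), 0 < r → (∀ x ∈ Icc 0 r, 1 ≤ Rf x ∧ Rf x ≤ 2) →
        (∃ L : NNReal, LipschitzOnWith L Rf (Icc 0 r)) →
        ∀ (a₀ θ₀ : T3 → ℝ) (u₀ : T3 → V3), Continuous a₀ → Continuous θ₀ → Continuous u₀ →
          (∀ x, 0 < a₀ x) → (∀ x, 0 < θ₀ x) →
          ∃ σ₀ : ℝ, 0 < σ₀ ∧ ∀ σ : ℝ, 0 < σ → σ < σ₀ →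
            ∀ (T : ℝ) (ρ θ : ℝ → T3 → ℝ) (u : ℝ → T3 → V3), IsHardSphereEulerSolution σ T ρ u θ →
              (∀ s ∈ Set.Ico 0 T, ∀ x, ρ s x * σ ^ 3 < η) →
              ∀ Φ : (N : ℕ) → HardSphereFlow (Torus.geometry (Fin 3)) (hsDiameter σ N) (N + 1),
                TendstoHydroFieldsAt (fun N => localGibbsLaw σ a₀ u₀ θ₀ N (Φ N)) Φ ρ u θ 0 →
                ∀ t ∈ Set.Ioo 0 T, (∀ s ∈ Set.Icc 0 t, ∀ x, ρ s x * σ ^ 3 < r) →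
                  ∀ τ : ℝ, 0 < τ → ∀ ε : ℝ, 0 < ε → ∃ N₀ : ℕ, ∀ N : ℕ, N₀ ≤ N →
                    ∀ s ∈ Set.Icc 0 t, ∀ s' ∈ Set.Icc 0 t, s ≤ s' → s' ≤ s + τ * ((N : ℝ) + 1) ^ (-(1 / 3 : ℝ)) →
                      |(klDiv ((Φ N).lawAt (localGibbsLaw σ a₀ u₀ θ₀ N (Φ N)) s')
                          (localGibbsLaw σ (fun x => ρ s' x * Rf (σ ^ 3 * ρ s' x)) (u s') (θ s') N (Φ N))).toReal -
                        (klDiv ((Φ N).lawAt (localGibbsLaw σ a₀ u₀ θ₀ N (Φ N)) s)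
                          (localGibbsLaw σ (fun x => ρ s x * Rf (σ ^ 3 * ρ s x)) (u s) (θ s) N (Φ N))).toReal| ≤
                      ((N : ℝ) + 1) * ε := by
  intro r Rf hr hRf hRfL a₀ θ₀ u₀ ha hθ hu ha0 hθ0
  obtain ⟨σ₁, hσ₁, h1⟩ := hCAT a₀ θ₀ u₀ ha hθ hu ha0 hθ0
  obtain ⟨σ₂, hσ₂, h2⟩ := hCEAT a₀ θ₀ u₀ ha hθ hu ha0 hθ0
  obtain ⟨σ₃, hσ₃, h3⟩ := hECT a₀ θ₀ u₀ ha hθ hu ha0 hθ0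
  refine ⟨min (min σ₁ σ₂) (min σ₃ (1 / 2)), lt_min (lt_min hσ₁ hσ₂) (lt_min hσ₃ one_half_pos),
    fun σ hσ hσlt T ρ θ u hE hguard Φ hlim t ht hpack τ hτ ε hε => ?_⟩
  have hσ1 : σ < σ₁ := hσlt.trans_le ((min_le_left _ _).trans (min_le_left _ _))
  have hσ2' : σ < σ₂ := hσlt.trans_le ((min_le_left _ _).trans (min_le_right _ _))
  have hσ3 : σ < σ₃ := hσlt.trans_le ((min_le_right _ _).trans (min_le_left _ _))
  have hσhalf : σ < 1 / 2 := hσlt.trans_le ((min_le_right _ _).trans (min_le_right _ _))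
  have ht0T : t ∈ Ico 0 T := ⟨ht.1.le, ht.2⟩
  have htT : Icc 0 t ⊆ Ico 0 T := Icc_subset_Ico_right ht.2
  -- the three inputs, each at ONE fixed level (the guard is handed to the guarded cubic tails)
  obtain ⟨V₁, hV₁, hCAT1⟩ := h1 σ hσ hσ1 T ρ θ u hE Φ hlim t ht0T
  obtain ⟨τ₁, hτ₁, hCAT2⟩ := hCAT1 V₁ le_rfl 1 one_pos
  obtain ⟨N₁, hN₁⟩ := hCAT2 (max τ₁ τ) (le_max_left _ _)
  obtain ⟨V₂, hV₂, hCEAT1⟩ := h2 σ hσ hσ2' T ρ θ u hE Φ hlim t ht0T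
  obtain ⟨τ₂, hτ₂, hCEAT2⟩ := hCEAT1 V₂ le_rfl 1 one_pos
  obtain ⟨N₂, hN₂⟩ := hCEAT2 (max τ₂ τ) (le_max_left _ _)
  obtain ⟨M, N₃, hN₃⟩ := h3 σ hσ hσ3 T ρ θ u hE hguard Φ hlim t ht0T 1 one_pos
  have hτ₁' : 0 < max τ₁ τ := lt_max_of_lt_left hτ₁
  have hτ₂' : 0 < max τ₂ τ := lt_max_of_lt_left hτ₂
  -- slab constants of the Euler solution
  obtain ⟨K, hK0, hK⟩ :=
    exists_abs_DgExp_one_le hE.smooth_temperature hE.smooth_velocity hE.temperature_pos ht.2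
  choose Lb hLb0 hLb using fun j : Fin 3 => exists_lipschitz_slab
    (isSmoothSpaceTimeOn_momPart hE.smooth_temperature hE.smooth_velocity hE.temperature_pos j) ht.1 ht.2
  obtain ⟨Lγ, hLγ0, hLγ⟩ := exists_lipschitz_slab
    (isSmoothSpaceTimeOn_inv hE.smooth_temperature hE.temperature_pos) ht.1 ht.2
  have hSL0 : 0 ≤ ∑ j, Lb j := Finset.sum_nonneg fun j _ => hLb0 j
  set L : ℝ := ∑ j, Lb j + Lγ with hLdef
  have hL0 : 0 ≤ L := by positivity
  have hd0 : ∀ x x' : T3, 0 ≤ Torus.euclidDist x x' := fun x x' => by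
    rw [Torus.euclidDist_eq]; exact norm_nonneg _
  have hβ : ∀ r' ∈ Icc 0 t, ∀ (x x' : T3) (j : Fin 3),
      |u r' x j / θ r' x - u r' x' j / θ r' x'| ≤ L * Torus.euclidDist x x' := by
    intro r' hr' x x' j
    have h := hLb j r' hr' r' hr' x x'
    rw [sub_self, abs_zero, zero_add, Real.norm_eq_abs] at h
    refine h.trans (mul_le_mul_of_nonneg_right ?_ (hd0 x x'))
    have := Finset.single_le_sum (fun j _ => hLb0 j) (Finset.mem_univ j)
    rw [hLdef]
    linarith
  have hγ : ∀ r' ∈ Icc 0 t, ∀ x x' : T3, |(θ r' x)⁻¹ - (θ r' x')⁻¹| ≤ L * Torus.euclidDist x x' := by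
    intro r' hr' x x'
    have h := hLγ r' hr' r' hr' x x'
    rw [sub_self, abs_zero, zero_add, Real.norm_eq_abs] at h
    refine h.trans (mul_le_mul_of_nonneg_right ?_ (hd0 x x'))
    rw [hLdef]
    linarith
  obtain ⟨Kρ, hKρ0, hKρ⟩ := exists_lipschitz_slab hE.smooth_density ht.1 ht.2
  -- a positive lower bound on the density over the slab
  obtain ⟨Ki, hKi⟩ := (isSmoothSpaceTimeOn_inv hE.smooth_density hE.density_pos).exists_norm_le_of_isCompact
    isCompact_Icc htT
  have hm : ∀ s₁ ∈ Icc 0 t, ∀ x, (|Ki| + 1)⁻¹ ≤ ρ s₁ x := by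
    intro s₁ hs₁ x
    have hρ := hE.density_pos s₁ (htT hs₁) x
    have h := hKi s₁ hs₁ x
    rw [Real.norm_eq_abs] at h
    rw [inv_le_comm₀ (by positivity) hρ]
    linarith [le_abs_self (ρ s₁ x)⁻¹, le_abs_self Ki]
  -- the Lipschitz constant of the insertion factor
  obtain ⟨LR, hLR⟩ := hRfL
  -- the second moment of the velocities at time zero
  obtain ⟨U, -, hU⟩ := exists_forall_abs_le_of_continuous (χ := fun x => ‖u₀ x‖) hu.norm
  obtain ⟨Θ, -, hΘ⟩ := exists_forall_abs_le_of_continuous hθ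
  have hΘ0 : 0 ≤ Θ := (abs_nonneg _).trans (hΘ 0)
  have hCKE0 : 0 ≤ U ^ 2 + 3 * Θ := by positivity
  have hKE : ∀ N, ∫⁻ z, ENNReal.ofReal (((N : ℝ) + 1)⁻¹ * ∑ i, ‖(z i).2‖ ^ 2)
      ∂(localGibbsLaw σ a₀ u₀ θ₀ N (Φ N)) ≤ ENNReal.ofReal (U ^ 2 + 3 * Θ) := by
    intro N
    rw [localGibbsLaw_eq]
    refine lintegral_meanVelObs_localGibbsMeasure_le ha hθ hu (fun x => (ha0 x).le) hθ0
      (f := fun v : V3 => ‖v‖ ^ 2) (by fun_prop) (fun v => sq_nonneg _) (fun y => ?_) σ N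
    rw [lintegral_norm_sq_gaussMeasure (u₀ y) (hθ0 y)]
    have h1 : ‖u₀ y‖ ≤ U := by simpa only [abs_of_nonneg (norm_nonneg _)] using hU y
    exact ENNReal.ofReal_le_ofReal (by
      nlinarith [(le_abs_self _).trans (hΘ y), pow_le_pow_left₀ (norm_nonneg _) h1 2])
  -- the total constant and the threshold in `N`
  set A₁ : ℝ := K * (2 + max M 0 * (U ^ 2 + 3 * Θ)) +
    (((|Ki| + 1)⁻¹)⁻¹ + LR * σ ^ 3) * Kρ * (3 + (U ^ 2 + 3 * Θ)) / 2 +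
    (((|Ki| + 1)⁻¹)⁻¹ + LR * σ ^ 3) * Kρ with hA₁
  have hA₁0 : 0 ≤ A₁ := by positivity
  set Ktot : ℝ := τ * A₁ + 4 * L * (max τ₁ τ * (V₁ + 1) + max τ₂ τ * (V₂ + 1)) + 1 with hKtot
  have hKtot0 : 0 < Ktot := by positivity
  have hν : Tendsto (fun N : ℕ => ((N : ℝ) + 1) ^ (-(1 / 3 : ℝ))) atTop (𝓝 0) :=
    (tendsto_rpow_neg_atTop (by norm_num : (0 : ℝ) < 1 / 3)).comp
      (tendsto_atTop_add_const_right _ 1 tendsto_natCast_atTop_atTop)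
  obtain ⟨N₄, hN₄⟩ := eventually_atTop.1 (hν.eventually_lt_const (div_pos hε hKtot0))
  refine ⟨max (max N₁ N₂) (max N₃ N₄), fun N hN s hs s' hs' hss' hs'le => ?_⟩
  have hN1 : N₁ ≤ N := ((le_max_left _ _).trans (le_max_left _ _)).trans hN
  have hN2 : N₂ ≤ N := ((le_max_right _ _).trans (le_max_left _ _)).trans hN
  have hN3 : N₃ ≤ N := ((le_max_left _ _).trans (le_max_right _ _)).trans hN
  have hN4 : N₄ ≤ N := ((le_max_right _ _).trans (le_max_right _ _)).trans hN
  set ν : ℝ := ((N : ℝ) + 1) ^ (-(1 / 3 : ℝ)) with hνdef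
  have hν0 : 0 < ν := Real.rpow_pos_of_pos (by positivity) _
  have hνle : ν ≤ ε / Ktot := (hN₄ N hN4).le
  have hεN : hsDiameter σ N = σ * ν := by
    rw [hνdef, hsDiameter]
    push_cast
    ring
  -- the one-window estimate at this `N`
  have hmain := abs_klDiv_window_sub_le hσ hσhalf ha hθ hu ha0 hθ0 hE ht hRf hLR hpack N (Φ N) hK0 hK hL0 hβ hγ
    hKρ0 hKρ (m := (|Ki| + 1)⁻¹) (by positivity) hm hCKE0 (hKE N) (M := M)
    (fun r' hr' => hN₃ N hN3 r' hr') hV₁.le (κ₁ := σ / max τ₁ τ) (w₁ := max τ₁ τ * ν) (div_pos hσ hτ₁')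
    (fun s₁ hs₁ => by
      have h := hN₁ N hN1 s₁ hs₁
      dsimp only at h
      exact h)
    hV₂.le (κ₂ := σ / max τ₂ τ) (w₂ := max τ₂ τ * ν) (div_pos hσ hτ₂')
    (fun s₁ hs₁ => by
      have h := hN₂ N hN2 s₁ hs₁
      dsimp only at h
      exact h)
    hs hs' hss'
    (hs'le.trans (add_le_add le_rfl (mul_le_mul_of_nonneg_right (le_max_right τ₁ τ) hν0.le)))
    (hs'le.trans (add_le_add le_rfl (mul_le_mul_of_nonneg_right (le_max_right τ₂ τ) hν0.le)))
  refine hmain.trans ?_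
  -- bookkeeping: everything is `(N+1) ν_N · const`
  have hN0 : (0 : ℝ) < (N : ℝ) + 1 := by positivity
  have hss : s' - s ≤ τ * ν := by linarith [hs'le]
  have step1 : (s' - s) * (((N : ℝ) + 1) * A₁) ≤ τ * ν * (((N : ℝ) + 1) * A₁) :=
    mul_le_mul_of_nonneg_right hss (by positivity)
  have step2 : 4 * L * hsDiameter σ N *
      (((N : ℝ) + 1) * ((σ / max τ₁ τ)⁻¹ * (V₁ + 1) + (σ / max τ₂ τ)⁻¹ * (V₂ + 1))) =
      ν * ((N : ℝ) + 1) * (4 * L * (max τ₁ τ * (V₁ + 1) + max τ₂ τ * (V₂ + 1))) := by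
    rw [hεN, inv_div, inv_div]
    field_simp
  have hνK : ν * Ktot ≤ ε := by rwa [← le_div_iff₀ hKtot0]
  calc (s' - s) * (((N : ℝ) + 1) * A₁) + 4 * L * hsDiameter σ N *
        (((N : ℝ) + 1) * ((σ / max τ₁ τ)⁻¹ * (V₁ + 1) + (σ / max τ₂ τ)⁻¹ * (V₂ + 1)))
      ≤ τ * ν * (((N : ℝ) + 1) * A₁) +
          ν * ((N : ℝ) + 1) * (4 * L * (max τ₁ τ * (V₁ + 1) + max τ₂ τ * (V₂ + 1))) := by
        rw [step2]
        linarith [step1]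
    _ = ((N : ℝ) + 1) * (ν * (Ktot - 1)) := by
        rw [hKtot]
        ring
    _ ≤ ((N : ℝ) + 1) * (ν * Ktot) := by
        refine mul_le_mul_of_nonneg_left (mul_le_mul_of_nonneg_left (by linarith) hν0.le) hN0.le
    _ ≤ ((N : ℝ) + 1) * ε := mul_le_mul_of_nonneg_left hνK hN0.le

/-- **The integrated ledger from the static one-window ledger and the GUARDED window continuity.** The proof
of the landed `ClampedCurrentsDockFromWindows.stub_ledgerFromWindowsS` verbatim with the packing level
`ηp := min ηp₁ (min (r/2) η)`, so that the solutions it quantifies over are guarded at level `η` on `[0,T)`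
(feeding `WindowContinuityInBandBelow η`) as well as at `ηp₁` (the static ledger) and `r/2` (the band);
a-priori bound `EntropyClockDock.ledgerAprioriBound`, `H_N(0) = 0` by `QuenchedCellClock.stub_timeZeroReference`,
summation by `ClampedCurrentsDockFromWindows.integrated_of_windows`. [cite: Yau1991, §2] -/
theorem glue_ledgerOfStaticAndContinuityBelow {η : ℝ} (hη : 0 < η) (hW : OneWindowLedgerStatic)
    (hWC : ∀ (r : ℝ) (Rf : ℝ → ℝ), 0 < r → (∀ x ∈ Icc 0 r, 1 ≤ Rf x ∧ Rf x ≤ 2) →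
          (∃ L : NNReal, LipschitzOnWith L Rf (Icc 0 r)) →
          ∀ (a₀ θ₀ : T3 → ℝ) (u₀ : T3 → V3), Continuous a₀ → Continuous θ₀ → Continuous u₀ →
            (∀ x, 0 < a₀ x) → (∀ x, 0 < θ₀ x) →
            ∃ σ₀ : ℝ, 0 < σ₀ ∧ ∀ σ : ℝ, 0 < σ → σ < σ₀ →
              ∀ (T : ℝ) (ρ θ : ℝ → T3 → ℝ) (u : ℝ → T3 → V3), IsHardSphereEulerSolution σ T ρ u θ →
                (∀ s ∈ Set.Ico 0 T, ∀ x, ρ s x * σ ^ 3 < η) →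
                ∀ Φ : (N : ℕ) → HardSphereFlow (Torus.geometry (Fin 3)) (hsDiameter σ N) (N + 1),
                  TendstoHydroFieldsAt (fun N => localGibbsLaw σ a₀ u₀ θ₀ N (Φ N)) Φ ρ u θ 0 →
                  ∀ t ∈ Set.Ioo 0 T, (∀ s ∈ Set.Icc 0 t, ∀ x, ρ s x * σ ^ 3 < r) →
                    ∀ τ : ℝ, 0 < τ → ∀ ε : ℝ, 0 < ε → ∃ N₀ : ℕ, ∀ N : ℕ, N₀ ≤ N →
                      ∀ s ∈ Set.Icc 0 t, ∀ s' ∈ Set.Icc 0 t, s ≤ s' → s' ≤ s + τ * ((N : ℝ) + 1) ^ (-(1 / 3 : ℝ)) →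
                        |(klDiv ((Φ N).lawAt (localGibbsLaw σ a₀ u₀ θ₀ N (Φ N)) s')
                            (localGibbsLaw σ (fun x => ρ s' x * Rf (σ ^ 3 * ρ s' x)) (u s') (θ s') N (Φ N))).toReal -
                          (klDiv ((Φ N).lawAt (localGibbsLaw σ a₀ u₀ θ₀ N (Φ N)) s)
                            (localGibbsLaw σ (fun x => ρ s x * Rf (σ ^ 3 * ρ s x)) (u s) (θ s) N (Φ N))).toReal| ≤
                        ((N : ℝ) + 1) * ε) :
    LedgerIntegratedCoreInBand := by
  intro r Rf hr hps hLip hsol hbd hcont huniq η₀ hη₀ HU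
  obtain ⟨ηp₁, hηp₁, H1p⟩ := hW r Rf hr hps hLip hsol hbd hcont huniq η₀ hη₀ HU
  refine ⟨min ηp₁ (min (r / 2) η), lt_min hηp₁ (lt_min (half_pos hr) hη), fun a₀ θ₀ u₀ ha hθ hu ha0 hθ0 => ?_⟩
  obtain ⟨σ₁, hσ₁, H1⟩ := H1p a₀ θ₀ u₀ ha hθ hu ha0 hθ0
  obtain ⟨σ₂, hσ₂, H2⟩ := hWC r Rf hr hbd hLip a₀ θ₀ u₀ ha hθ hu ha0 hθ0
  obtain ⟨σ₃, hσ₃, H3⟩ :=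
    QuenchedCellClock.stub_timeZeroReference hr hsol hbd hcont huniq a₀ θ₀ u₀ ha hθ hu ha0 hθ0
  refine ⟨min σ₁ (min σ₂ (min σ₃ (1 / 2))), lt_min hσ₁ (lt_min hσ₂ (lt_min hσ₃ (by norm_num))), ?_⟩
  intro σ hσ hσlt T ρ θ u hEul hguard Φ htie t ht
  simp only [lt_min_iff] at hσlt
  obtain ⟨hσ1, hσ2, hσ3, hσh⟩ := hσlt
  have hguard₁ : ∀ s ∈ Set.Ico 0 T, ∀ x, ρ s x * σ ^ 3 < ηp₁ := fun s hs x =>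
    (hguard s hs x).trans_le (min_le_left _ _)
  have hguardη : ∀ s ∈ Set.Ico 0 T, ∀ x, ρ s x * σ ^ 3 < η := fun s hs x =>
    (hguard s hs x).trans_le ((min_le_right _ _).trans (min_le_right _ _))
  have hpack : ∀ s ∈ Set.Icc 0 t, ∀ x, ρ s x * σ ^ 3 < r := fun s hs x =>
    ((hguard s ⟨hs.1, hs.2.trans_lt ht.2⟩ x).trans_le
      ((min_le_right _ _).trans (min_le_left _ _))).trans (half_lt_self hr)
  obtain ⟨K, hK, Cst, hCst, hstat, hwin⟩ := H1 σ hσ hσ1 T ρ θ u hEul hguard₁ Φ htie t ht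
  have hcw := H2 σ hσ hσ2 T ρ θ u hEul hguardη Φ htie t ht hpack
  have hlaw0 := H3 σ hσ hσ3 T ρ θ u hEul (ht.1.trans ht.2) Φ htie
  refine ⟨2 * K, by positivity, fun ε hε => ?_⟩
  have ht0 : 0 < t := ht.1
  set e : ℝ := ε / (4 * (1 + t)) with he_def
  have he : 0 < e := by positivity
  obtain ⟨τ, hτ, N₁, hN₁⟩ := hwin e he
  obtain ⟨N₂, hN₂⟩ := hstat e he
  obtain ⟨N₃, hN₃⟩ := hcw τ hτ e he
  -- uniform continuity of the static rate on the compact `[0, t]`; the windows shrink, `w_N = τ (N+1)^{-1/3} → 0`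
  obtain ⟨δ, hδ, hUC⟩ :=
    Metric.uniformContinuousOn_iff_le.1 (isCompact_Icc.uniformContinuousOn_of_continuous hCst) e he
  have hwlim : Tendsto (fun N : ℕ => τ * ((N : ℝ) + 1) ^ (-(1 / 3 : ℝ))) atTop (𝓝 0) := by
    have h := ((tendsto_rpow_neg_atTop (by norm_num : (0 : ℝ) < 1 / 3)).comp
      (tendsto_atTop_add_const_right _ 1 tendsto_natCast_atTop_atTop)).const_mul τ
    rw [mul_zero] at h
    exact h
  have hKlim := hwlim.const_mul K
  rw [mul_zero] at hKlim
  obtain ⟨N₄, hN₄⟩ := eventually_atTop.1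
    ((hwlim.eventually_le_const hδ).and (hKlim.eventually_le_const (by norm_num : (0 : ℝ) < 1 / 2)))
  refine ⟨max N₁ (max N₂ (max N₃ N₄)), fun N hN t' ht' => ?_⟩
  simp only [max_le_iff] at hN
  obtain ⟨hN1, hN2, hN3, hN4⟩ := hN
  obtain ⟨hwδ, hKw⟩ := hN₄ N hN4
  obtain ⟨B, hBN⟩ := EntropyClockDock.ledgerAprioriBound r Rf hr hbd hcont a₀ θ₀ u₀ ha hθ hu ha0 hθ0 σ hσ hσh
    T ρ θ u hEul t ht hpack N (Φ N)
  have key := integrated_of_windows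
    (H := fun s => (klDiv ((Φ N).lawAt (localGibbsLaw σ a₀ u₀ θ₀ N (Φ N)) s)
      (localGibbsLaw σ (fun x => ρ s x * Rf (σ ^ 3 * ρ s x)) (u s) (θ s) N (Φ N))).toReal)
    (L := fun s => Real.log (posPartition (fun x => ρ s x * Rf (σ ^ 3 * ρ s x)) (hsDiameter σ N) (N + 1)))
    (Cst := Cst) (t := t) (M := (N : ℝ) + 1) (K := K) (w := τ * ((N : ℝ) + 1) ^ (-(1 / 3 : ℝ))) (e := e)
    (B := max B 0) (by positivity) hK (mul_pos hτ (Real.rpow_pos_of_pos (by positivity) _)) he.le hKw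
    (fun s => ENNReal.toReal_nonneg)
    (fun s hs => ENNReal.toReal_le_of_le_ofReal (le_max_right _ _)
      ((hBN s hs).trans (ENNReal.ofReal_le_ofReal (le_max_left _ _))))
    (by simp only [hlaw0 N, EntropyClockDock.klDiv_lawAt_zero_localGibbsLaw hσh.le ha hθ hu ha0 hθ0 N (Φ N),
          ENNReal.toReal_zero])
    (hN₁ N hN1) (hN₂ N hN2) (hN₃ N hN3) hCst
    (fun x hx y hy hxy hyx => by
      have h := hUC y hy x hx (by rw [Real.dist_eq, abs_of_nonneg (sub_nonneg.2 hxy)]; linarith)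
      rwa [Real.dist_eq] at h)
    ht'
  have h4t : (4 : ℝ) * (1 + t) ≠ 0 := by positivity
  have hεe : ((N : ℝ) + 1) * (4 * (1 + t) * e) = ((N : ℝ) + 1) * ε := by rw [he_def]; field_simp
  rwa [hεe] at key

/-- **Composition: the v4 stub 4 from the reshaped stub 4a and the two true-law activity inputs**, the
cubic-tail input staying GUARDED.  For `η > 0`: 4a gives the static ledger; CAT, CEAT and
`EnergyCurrentTailsBelow η` give `WindowContinuityInBandBelow η`; the guarded summation concludes. -/
theorem glue_ballwiseLedger_of_static_of_activityTails
    (hS : ∀ η : ℝ, 0 < η → VisibleFluxGibbsianity → EnergyCurrentTailsBelow η →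
      FastCollisionThroughputBelow η → OneWindowLedgerStatic)
    (hC : OneFlightGossipEngine.CollisionActivityTails) (hE : HydroLimitInBandOfHeart.CollisionEnergyActivityTails) :
    ∀ η : ℝ, 0 < η → VisibleFluxGibbsianity → EnergyCurrentTailsBelow η → FastCollisionThroughputBelow η →
      LedgerIntegratedCoreInBand :=
  fun η hη hV hT hF => glue_ledgerOfStaticAndContinuityBelow hη (hS η hη hV hT hF)
    (glue_windowContinuityInBandBelow_of_tails η hC hE hT)

end Summit.AtomisticToContinuum.HydrodynamicLimit.Theorems.LTEInBand

end
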